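import Literature.AnabelianGeometry.SemiGraphs.SectionFibreSaturation
import HarnessLib

/-!
# Section fibres along a restricted covering: the vertex ⇒ edge step on LOCALISED labels ([SemiAnbd] §2, Cor. 2.7 (i) p. 30)

Mochizuki, *Semi-graphs of anabelioids*, Publ. RIMS **42** (2006), §2, proof of Cor. 2.7 (i) p. 30
("`ℋ′` injects into `𝒢′` as a subgraph") [cite: MochizukiSemiAnbd2006, Cor. 2.7(i) p.30]; Def. 2.2 (i)
p. 23 (vertices / edges of the covering are the components of the `A_v` / `A_e`).

PROOF-ONLY (abc-iut cell, layer L3; FACT-LIST row F-1487 `covering_subgraphComponents_doubleCosets`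
AS TYPED, CLASS route, brick R6c «LOCALISED TIE», file E2b (part 1); seat abc-iut-f-161 (gen 13),
L3-lead ζ3; SHAPES `HOME/staging/f/f-161/g13/SHAPES-R6c.md`).  abc-iut-L3-d3's sheet walk consumes the
section labels `(oV, oE)` of abc-iut-f-161's TIE through two binders: INJECTIVITY of `w ↦ (φ w, oV w)`
on all of `𝒢′` and SURJECTIVITY of `e′ ↦ (φ e′, oE e′)` onto all of `Σ_e π₀(A_e)`.  Its vertex ⇒ edge
step (`Hom.walkStep_vertex_to_edge`) uses surjectivity only at a cell over an edge of `ℍ` and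
injectivity only between two vertices over the end of a branch of `ℍ` — exactly what the LOCALISED TIE
`Hom.tie_localLabels_of_sectionE_surjectiveOn` (file E2a) delivers from detection of the cells over
`ℍ.edges` alone.  This file re-runs the step on those binders:

* `Hom.walkStep_vertex_to_edge_over` — abc-iut-L3-d3's `walkStep_vertex_to_edge` with the two label
  binders LOCALISED to `ℍ` (all other binders byte-identical, proof verbatim but for the two lines that
  touch the labels).

No definition, no instance, no new named fact; a strict generalisation (weaker hypotheses, same
conclusion) of the tree theorem, which is not restated; typed ≠ proved for F-1487 AS TYPED
(OPEN-AS-TYPED, L3-lead δ22); CLASS route ≠ the fact; nothing here takes a side on [IUTchIII] Cor. 3.12.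
-/

namespace Literature.AnabelianGeometry.SemiGraphs

open CategoryTheory CategoryTheory.Limits CategoryTheory.PreGaloisCategory
open Literature.AnabelianGeometry.Anabelioids

universe v₁ u₁ u

namespace SemiGraphOfAnabelioids

variable {𝒢 𝒢' : SemiGraphOfAnabelioids.{v₁, u₁, u}}

/-! ### Vertex ⇒ edge: finding the edge of `K` through the LOCALISED labels -/

/-- **Vertex ⇒ edge step of the sheet walk, LOCALISED labels.**  Let `w ∈ K` with `c ⊆ Y_u`
(`u = φ w`) a component LABELLED by `oV w` (`f|_c` factors through `oV w ↪ A_u`) whose section fibre `Ψ_c` factors through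
`W_w`; let `b₁` be a branch of `ℍ` abutting to `u` and `d ⊆ Y_{e}` (`e` the edge of `b₁`) a component
under `c` along `b₁`.  Then there is an edge `e′ ∈ K` over `e` — the `oE`-preimage of the component of
`A_e` holding `f(d)`; its branch over `b₁` abuts to `w` by the branch clause and the injectivity of the
vertex labels (here: injectivity only among vertices over the end of an `ℍ`-branch, surjectivity of
the edge labels only onto the cells over `ℍ.edges`) — such that `W_{e′}` MEETS the edge section fibre
`Ψ_d` (for some basepoint).  abc-iut-L3-d3's `walkStep_vertex_to_edge` verbatim on the localised binders.
[cite: MochizukiSemiAnbd2006, Cor. 2.7(i) p.30] -/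
theorem Hom.walkStep_vertex_to_edge_over (φ : Hom 𝒢' 𝒢) (A : 𝒢.BObj) (H : 𝒢.graph.Subgraph)
    (K : 𝒢'.graph.Subgraph) (hKV : K.verts ⊆ φ.base.vertexMap ⁻¹' H.verts)
    (hKE : K.edges ⊆ φ.base.edgeMap ⁻¹' H.edges) (hK : φ.IsPreimageComponent H K)
    (hprop : SemiGraph.IsProper φ.base) (hHg : H.toSemiGraph.IsGraph)
    (T : 𝒢'.BObj) (hTV : ∀ v', IsTerminal (T.S v')) (hTE : ∀ e', IsTerminal (T.T e'))
    (s : T ⟶ φ.pullbackFunctor.obj A)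
    (oV : ∀ v' : 𝒢'.graph.Vertex, π₀Obj (A.S (φ.base.vertexMap v')))
    (oE : ∀ e' : 𝒢'.graph.Edge, π₀Obj (A.T (φ.base.edgeMap e')))
    (hoV : ∀ (w₁ w₂ : 𝒢'.graph.Vertex) (b : 𝒢.graph.Branch), 𝒢.graph.edgeOf b ∈ H.edges →
      𝒢.graph.abuts b = some (φ.base.vertexMap w₁) →
      (⟨φ.base.vertexMap w₁, oV w₁⟩ : Σ v, π₀Obj (A.S v)) = ⟨φ.base.vertexMap w₂, oV w₂⟩ → w₁ = w₂)
    (hoE : ∀ e ∈ H.edges, ∀ Q : π₀Obj (A.T e), ∃ e' : 𝒢'.graph.Edge,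
      (⟨φ.base.edgeMap e', oE e'⟩ : Σ e, π₀Obj (A.T e)) = ⟨e, Q⟩)
    (hobr : ∀ (b' : 𝒢'.graph.Branch) (v' : 𝒢'.graph.Vertex) (h' : 𝒢'.graph.abuts b' = some v'),
      ∃ f : ((oE (𝒢'.graph.edgeOf b')).1 : 𝒢.E (φ.base.edgeMap (𝒢'.graph.edgeOf b'))) ⟶
          (𝒢.transportE (φ.base.edgeOf_branchMap b')).obj
            ((𝒢.pull (φ.base.branchMap b') (φ.base.vertexMap v')
              (φ.base.abuts_branchMap b' v' h')).pullback.obj ((oV v').1 : 𝒢.V (φ.base.vertexMap v'))),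
        f ≫ (𝒢.transportE (φ.base.edgeOf_branchMap b')).map
              ((𝒢.pull _ _ (φ.base.abuts_branchMap b' v' h')).pullback.map (oV v').1.arrow ≫
                (A.ψ (φ.base.branchMap b') (φ.base.vertexMap v') (φ.base.abuts_branchMap b' v' h')).hom) ≫
            eqToHom (𝒢.transportE_obj_T A (φ.base.edgeOf_branchMap b')) =
          (oE (𝒢'.graph.edgeOf b')).1.arrow)
    (hsE : ∀ e', ∃ k : T.T e' ⟶ (φ.φE e' (φ.base.edgeMap e') rfl).pullback.obj (oE e').1,
      k ≫ (φ.φE e' (φ.base.edgeMap e') rfl).pullback.map (oE e').1.arrow = s.fT e')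
    (Y : (𝒢.restrict H).BObj) (f : Y ⟶ (𝒢.restrictFunctor H).obj A)
    {W : (𝒢'.restrict K).BObj} (j : W ⟶ (φ.restrict K H hKV hKE).pullbackFunctor.obj Y) [Mono j]
    (w : 𝒢'.graph.Vertex) (hw : w ∈ K.verts) (b₁ : 𝒢.graph.Branch)
    (hb₁H : 𝒢.graph.edgeOf b₁ ∈ H.edges) (hb₁w : 𝒢.graph.abuts b₁ = some (φ.base.vertexMap w))
    (c : π₀Obj (Y.S ⟨φ.base.vertexMap w, hKV hw⟩)) (d : π₀Obj (Y.T ⟨𝒢.graph.edgeOf b₁, hb₁H⟩))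
    (hdc : d.1 ≤ Y.branchImage ⟨b₁, hb₁H⟩ ⟨φ.base.vertexMap w, hKV hw⟩
      ((SemiGraph.Subgraph.abuts_eq_some_iff H _ _).mpr hb₁w) c.1)
    (hlab : ∃ m : (Subobject.underlying.obj c.1 : 𝒢.V (φ.base.vertexMap w)) ⟶
        Subobject.underlying.obj (oV w).1,
      m ≫ (oV w).1.arrow = c.1.arrow ≫ f.fS ⟨φ.base.vertexMap w, hKV hw⟩)
    (hfac : ∃ g : pullback ((φ.φV w).pullback.map (c.1.arrow ≫ f.fS ⟨φ.base.vertexMap w, hKV hw⟩))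
        (s.fS w) ⟶ W.S ⟨w, hw⟩,
      g ≫ j.fS ⟨w, hw⟩ = pullback.fst ((φ.φV w).pullback.map
        (c.1.arrow ≫ f.fS ⟨φ.base.vertexMap w, hKV hw⟩)) (s.fS w) ≫ (φ.φV w).pullback.map c.1.arrow) :
    ∃ (e' : 𝒢'.graph.Edge) (he' : e' ∈ K.edges) (p : φ.base.edgeMap e' = 𝒢.graph.edgeOf b₁)
      (Fe : 𝒢'.E e' ⥤ FintypeCat.{v₁}) (_ : FiberFunctor Fe)
      (π : Fe.obj (pullback ((φ.φE e' (𝒢.graph.edgeOf b₁) p).pullback.map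
          (d.1.arrow ≫ f.fT ⟨𝒢.graph.edgeOf b₁, hb₁H⟩))
        (s.fT e' ≫ (φ.reindexIso e' (φ.base.edgeMap e') (𝒢.graph.edgeOf b₁) rfl p).hom.app A)))
      (ϖ : Fe.obj (W.T ⟨e', he'⟩)),
      Fe.map (j.fT ⟨e', he'⟩ ≫ ((φ.restrict K H hKV hKE).reindexIso ⟨e', he'⟩
          ⟨𝒢.graph.edgeOf b₁, hb₁H⟩ ⟨φ.base.edgeMap e', hKE he'⟩ (Subtype.ext p) rfl).inv.app Y) ϖ =
        Fe.map (pullback.fst _ _ ≫ (φ.φE e' (𝒢.graph.edgeOf b₁) p).pullback.map d.1.arrow) π := by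
  obtain ⟨mc, hmc⟩ := hlab
  obtain ⟨g, hg⟩ := hfac
  have hbu : H.toSemiGraph.abuts ⟨b₁, hb₁H⟩ = some (⟨φ.base.vertexMap w, hKV hw⟩ : H.toSemiGraph.Vertex) :=
    (SemiGraph.Subgraph.abuts_eq_some_iff H _ _).mpr hb₁w
  -- canonical names at the vertex
  let cY : 𝒢.V (φ.base.vertexMap w) := Subobject.underlying.obj c.1
  let dY : 𝒢.E (𝒢.graph.edgeOf b₁) := Subobject.underlying.obj d.1
  haveI : PreGaloisCategory.IsConnected cY := c.2
  haveI : PreGaloisCategory.IsConnected dY := d.2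
  let ιc : cY ⟶ Y.S ⟨φ.base.vertexMap w, hKV hw⟩ := c.1.arrow
  let ιd : dY ⟶ Y.T ⟨𝒢.graph.edgeOf b₁, hb₁H⟩ := d.1.arrow
  let bY : 𝒢.V (φ.base.vertexMap w) ⥤ 𝒢.E (𝒢.graph.edgeOf b₁) :=
    (𝒢.pull b₁ (φ.base.vertexMap w) hb₁w).pullback
  haveI : PreservesFiniteLimits bY := (𝒢.pull _ _ _).property.1
  haveI : PreservesFiniteColimits bY := (𝒢.pull _ _ _).property.2
  let Aψ := A.ψ b₁ (φ.base.vertexMap w) hb₁w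
  let Aψh : bY.obj (A.S (φ.base.vertexMap w)) ⟶ A.T (𝒢.graph.edgeOf b₁) := Aψ.hom
  let Yψh : bY.obj (Y.S ⟨φ.base.vertexMap w, hKV hw⟩) ⟶ Y.T ⟨𝒢.graph.edgeOf b₁, hb₁H⟩ :=
    (Y.ψ ⟨b₁, hb₁H⟩ ⟨φ.base.vertexMap w, hKV hw⟩ hbu).hom
  let fu : Y.S ⟨φ.base.vertexMap w, hKV hw⟩ ⟶ A.S (φ.base.vertexMap w) :=
    f.fS ⟨φ.base.vertexMap w, hKV hw⟩
  let fe : Y.T ⟨𝒢.graph.edgeOf b₁, hb₁H⟩ ⟶ A.T (𝒢.graph.edgeOf b₁) := f.fT ⟨𝒢.graph.edgeOf b₁, hb₁H⟩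
  let oa : Subobject.underlying.obj (oV w).1 ⟶ A.S (φ.base.vertexMap w) := (oV w).1.arrow
  -- `d` under `c`
  haveI hmono : Mono (((𝒢.restrict H).pull ⟨b₁, hb₁H⟩ ⟨φ.base.vertexMap w, hKV hw⟩
      hbu).pullback.map c.1.arrow ≫ (Y.ψ ⟨b₁, hb₁H⟩ ⟨φ.base.vertexMap w, hKV hw⟩ hbu).hom) :=
    Y.mono_map_arrow_comp_ψ _ _ hbu c.1
  let k : dY ⟶ bY.obj cY := @Subobject.ofLEMk _ _ _ _ d.1 _ hmono hdc
  have hk : k ≫ bY.map ιc ≫ Yψh = ιd := @Subobject.ofLEMk_comp _ _ _ _ d.1 _ hmono hdc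
  have hf : bY.map fu ≫ Aψh = Yψh ≫ fe := f.comm ⟨b₁, hb₁H⟩ ⟨φ.base.vertexMap w, hKV hw⟩ hbu
  have E1 : (k ≫ bY.map mc) ≫ bY.map oa ≫ Aψh = ιd ≫ fe := by
    calc (k ≫ bY.map mc) ≫ bY.map oa ≫ Aψh = k ≫ (bY.map mc ≫ bY.map oa) ≫ Aψh := by
          simp only [Category.assoc]
      _ = k ≫ bY.map (ιc ≫ fu) ≫ Aψh := by rw [← bY.map_comp, hmc]; rfl
      _ = k ≫ bY.map ιc ≫ (bY.map fu ≫ Aψh) := by rw [bY.map_comp, Category.assoc]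
      _ = k ≫ bY.map ιc ≫ Yψh ≫ fe := by rw [hf]
      _ = (k ≫ bY.map ιc ≫ Yψh) ≫ fe := by simp only [Category.assoc]
      _ = ιd ≫ fe := by rw [hk]
  -- the component `Q'` of `A_e` holding `f(d)`
  let FA := GaloisCategory.getFiberFunctor (𝒢.E (𝒢.graph.edgeOf b₁))
  obtain ⟨y₀⟩ := nonempty_fiber_of_isConnected FA dY
  obtain ⟨Q', hQ'⟩ := exists_component_mem_range FA (FA.map (ιd ≫ fe) y₀)
  haveI : PreGaloisCategory.IsConnected (Subobject.underlying.obj Q'.1) := Q'.2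
  obtain ⟨md, hmd⟩ := (factor_iff_map_mem_range FA Q'.1.arrow (ιd ≫ fe) y₀).mpr hQ'
  -- `Q'` lies under `oV w` along `b₁`
  have hcompw : A.componentOver b₁ (φ.base.vertexMap w) hb₁w Q' = oV w := by
    refine A.componentOver_eq_of_mem_ranges b₁ _ hb₁w Q' (oV w) FA (FA.map (ιd ≫ fe) y₀) hQ' ?_
    refine ⟨FA.map (k ≫ bY.map mc) y₀, ?_⟩
    have h := congrArg (fun m => FA.map m y₀) E1
    simpa only [Functor.map_comp, FintypeCat.comp_apply] using h
  -- the edge of `𝒢′` labelled `(e, Q')` and a branch of it over `b₁`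
  obtain ⟨f', hf'⟩ := hoE (𝒢.graph.edgeOf b₁) hb₁H Q'
  have pf : φ.base.edgeMap f' = 𝒢.graph.edgeOf b₁ := congrArg Sigma.fst hf'
  have hQ : HEq (oE f') Q' := (Sigma.mk.inj_iff.mp hf').2
  obtain ⟨β, w₃, hβf, hβb, hβω, hw₃⟩ :=
    SemiGraph.exists_branch_preimage_abuts φ.base hprop f' b₁ pf.symm (φ.base.vertexMap w) hb₁w
  subst hβf
  -- the branch `β` abuts to `w`: compare labels
  have hQt : ((pf ▸ oE (𝒢'.graph.edgeOf β) : π₀Obj (A.T (𝒢.graph.edgeOf b₁)))) = Q' :=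
    φ.eqRec_localLabel_eq_of_heq A oE pf hQ
  have hcomp3 : A.componentOver b₁ (φ.base.vertexMap w₃) (hβb ▸ φ.base.abuts_branchMap β w₃ hβω)
      (pf ▸ oE (𝒢'.graph.edgeOf β)) = oV w₃ :=
    φ.componentOver_localLabel_eq A oV oE hobr β w₃ hβω b₁ hβb
  have e1 : (⟨φ.base.vertexMap w₃, oV w₃⟩ : Σ v, π₀Obj (A.S v)) =
      ⟨φ.base.vertexMap w₃, A.componentOver b₁ (φ.base.vertexMap w₃)
        (hβb ▸ φ.base.abuts_branchMap β w₃ hβω) Q'⟩ := by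
    rw [← hQt, hcomp3]
  have e2 := A.sigma_componentOver_eq b₁ (φ.base.vertexMap w₃) (φ.base.vertexMap w)
    (hβb ▸ φ.base.abuts_branchMap β w₃ hβω) hb₁w Q'
  have e3 : (⟨φ.base.vertexMap w, A.componentOver b₁ (φ.base.vertexMap w) hb₁w Q'⟩ :
      Σ v, π₀Obj (A.S v)) = ⟨φ.base.vertexMap w, oV w⟩ := by rw [hcompw]
  have hw₃ : w₃ = w :=
    hoV w₃ w b₁ hb₁H (hβb ▸ φ.base.abuts_branchMap β w₃ hβω) (e1.trans (e2.trans e3))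
  subst w₃
  subst hβb
  -- hence the edge of `β` lies in `K`
  have hfK : 𝒢'.graph.edgeOf β ∈ K.edges :=
    hK.mem_edges_of_abuts hprop hHg hw hβω (by rw [pf]; exact hb₁H)
  -- the edge section fibre at `f′ = edgeOf β` has a point
  let Fe := GaloisCategory.getFiberFunctor (𝒢'.E (𝒢'.graph.edgeOf β))
  let Φe : 𝒢.E (𝒢.graph.edgeOf (φ.base.branchMap β)) ⥤ 𝒢'.E (𝒢'.graph.edgeOf β) :=
    (φ.φE (𝒢'.graph.edgeOf β) (𝒢.graph.edgeOf (φ.base.branchMap β)) pf).pullback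
  haveI : PreservesFiniteLimits Φe := (φ.φE _ _ _).property.1
  haveI : PreservesFiniteColimits Φe := (φ.φE _ _ _).property.2
  let FE : 𝒢.E (𝒢.graph.edgeOf (φ.base.branchMap β)) ⥤ FintypeCat.{v₁} := Φe ⋙ Fe
  haveI : FiberFunctor FE := fiberFunctor_comp_of_exact _ _
  let sE : T.T (𝒢'.graph.edgeOf β) ⟶ Φe.obj (A.T (𝒢.graph.edgeOf (φ.base.branchMap β))) :=
    s.fT (𝒢'.graph.edgeOf β) ≫
      (φ.reindexIso (𝒢'.graph.edgeOf β) (φ.base.edgeMap (𝒢'.graph.edgeOf β))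
        (𝒢.graph.edgeOf (φ.base.branchMap β)) rfl pf).hom.app A
  haveI : Subsingleton (Fe.obj (T.T (𝒢'.graph.edgeOf β))) :=
    subsingleton_fiber_of_isTerminal Fe (hTE _)
  obtain ⟨tE⟩ := nonempty_fiber_of_isTerminal Fe (hTE (𝒢'.graph.edgeOf β))
  obtain ⟨kE, hkE⟩ := φ.sectionE_factors_reindexed A s oE (𝒢'.graph.edgeOf β) (hsE _)
    (𝒢.graph.edgeOf (φ.base.branchMap β)) pf
  have hx : Fe.map sE tE ∈ Set.range (FE.map Q'.1.arrow) := by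
    rw [← hQt]
    refine ⟨Fe.map kE tE, ?_⟩
    change Fe.map (Φe.map _) (Fe.map kE tE) = _
    rw [← FintypeCat.comp_apply, ← Fe.map_comp]
    exact congrArg (fun m => Fe.map m tE) hkE
  obtain ⟨q, hq⟩ := hx
  obtain ⟨y₁⟩ := nonempty_fiber_of_isConnected FE dY
  obtain ⟨y, hyq⟩ := surjective_of_nonempty_fiber_of_isConnected FE md q
  have hy : Fe.map (Φe.map (ιd ≫ fe)) y = Fe.map sE tE := by
    rw [← hmd, ← hq, ← hyq]
    change Fe.map (Φe.map (md ≫ Q'.1.arrow)) y = Fe.map (Φe.map _) (Fe.map (Φe.map md) y)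
    rw [Φe.map_comp, Fe.map_comp, FintypeCat.comp_apply]
  let π : Fe.obj (pullback (Φe.map (ιd ≫ fe)) sE) :=
    (fiberPullbackEquiv Fe (Φe.map (ιd ≫ fe)) sE).symm ⟨(y, tE), hy⟩
  -- part C: vertex ⇒ edge
  obtain ⟨ϖ, hϖ⟩ := φ.sectionFibre_edge_meets_of_vertex_factors A H K hKV hKE T hTV hTE s β w hβω hw
    hfK hb₁H Y f j ιc ιd k hk g hg Fe π
  exact ⟨𝒢'.graph.edgeOf β, hfK, pf, Fe, inferInstance, π, ϖ, hϖ⟩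

end SemiGraphOfAnabelioids

end Literature.AnabelianGeometry.SemiGraphs
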